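import Summits.ResolutionOfSingularities.ResolutionOfSingularities.Theorems.HomologicalConductorNoZenoTraceSocleCurveTrace
import HarnessLib

/-!
# Crux `NoZenoR` (stmt-ResolutionOfSingularities-19943), slot 2 `stub_beta1RankOneSharpF`: the line `confined-surface` IN THE TREE, part 1 —
# the TRICHOTOMY on trace dominators (threadless transfer, cases (i)/(ii), the confined branch from the surface-confined residual)

OURS (cell res-hironaka, crux chain W4.4; line `confined-surface` r1 by res-L0-w44-strat-1 g11, 2e9a6b4082d4a94d; trace-socle facts 1–4 by
res-L0-w44-idea-1, ported to `Theorems.NoZeno.TraceSocle` by res-L0-w44-stub-1 (p540464, p541310, p542128, p543974); tree port of the line by the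
lead res-L0-w44-lead-1 g9, DESK WORD 36).  AI-written, weaker than expert review; nothing here is a statement of the manuscript under review
(Hironaka 2017).  SUPPORT-level, counted 0.  DEF-FREE: the three residuals and the registered slot text are written out VERBATIM as binder /
conclusion texts (the line file's `Sig.ShannonTransferSharp`, `Sig.Beta1SharpExhaustive`, `Sig.SurfaceConfinedResidualSharp`,
`Sig.SurfaceConfinedResidual`, `Sig.Beta1SharpConfined` with `Sig.Confined` unfolded, and the registered v28–v33 text
`Cruxes.NoZeno.Lines.Coarsening.Sig.stub_beta1RankOneSharp`); the four trace-socle facts are DISCHARGED BY NAME (`TraceSocle.exists_traceDominator`,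
`TraceSocle.terminates_of_noetherianResidualDominator`, `TraceSocle.curveCoarsening_terminates`, `TraceSocle.curveTrace_terminates`).

THE CUT (K-level).  β1ʳ¹♯ binders (kernel `hker`, maximality, IH in smaller tr.deg, `hzd`, `3 ≤ tr.deg`, RANK ONE), branch (b) (an unreachable
residually transcendental `t ∈ O`), THREADLESS, and the tail CONFINED by a valuation ring `W ⊇ T_(m₁)` (escape witness `s⁻¹ ∈ W ∖ O`, some
`t⁻¹ ∉ W`, all later stages inside `loc W (T_(m₁))`).  A TRACE DOMINATOR is a valuation ring `U ≤ W` dominating the tower; one exists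
(fact 1 + `TraceSocle.dominates_residueLift`).  TRICHOTOMY: (i) the image of `U` in `κ(W)` is noetherian ⇒ the tower terminates (fact 2;
`terminates_of_noetherianImage`); (ii) some intermediate `U < W₂ < W ∋ k` of residual transcendence degree `≤ 1` does not dominate ⇒ the
tower terminates (dominance invariance + threadless transfer + fact 3; `terminates_of_lowResidueIntermediate`); (iii) the RESIDUAL: every
trace dominator has non-noetherian image and every low-residue intermediate dominates.  SHARP FORM: one more binder — two stage elements
with algebraically independent `W`-residues — at the price of fact 4 (`surfaceConfinedResidual_of_sharp`).  Registry level: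
`beta1RankOneSharp_of_split` (exhaustive data → the exhaustive residual; confined branch-(b) data → the confined branch; unconfined
branch-(b) data contradict Shannon transfer) and **`beta1RankOneSharpF_of_residuals`**: the three residuals imply the registered type of
`stub_beta1RankOneSharpF` (`Sig.FactsW` unfolded → the slot text), the facts prefix being unused.  The three residuals are genuine
conjectures of this programme (no close is claimed); every later closer of slot 2 is BY NAME against this file.

References: W. Heinzer et al., arXiv:1505.06445 (Shannon's non-switching case); K. Kiyek, J. L. Vicente, *Resolution of curve and surface
singularities*, VIII (4.2), (4.4), (7.9); O. Zariski 1939.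
-/

noncomputable section

-- single-problem summit: the doubled namespace component `ResolutionOfSingularities` is forced
set_option linter.dupNamespace false

namespace Summit.ResolutionOfSingularities.ResolutionOfSingularities.Theorems.NoZeno.ConfinedSurface

open Summit.ResolutionOfSingularities.ResolutionOfSingularities.Theses.HomologicalConductor
open Summit.ResolutionOfSingularities.ResolutionOfSingularities.Theorems.NoZeno.Birth
open Summit.ResolutionOfSingularities.ResolutionOfSingularities.Theorems.NoZeno.SandwichCluster.Parasite
open Summit.ResolutionOfSingularities.ResolutionOfSingularities.Theorems
open Summit.ResolutionOfSingularities.ResolutionOfSingularities.Theorems.NoZeno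
open Summit.ResolutionOfSingularities.ResolutionOfSingularities.Theorems.NoZeno.TraceSocle
  (stage_le inv_mem_stage loc_le dominates_residueLift exists_traceDominator terminates_of_noetherianResidualDominator
   curveCoarsening_terminates curveTrace_terminates)
open Literature.AlgebraicGeometry.Resolution
open IsLocalRing

variable {k K : Type} [Field k] [Field K] [Algebra k K]

/-! ## §2 (PROVED) Threadless transfer along dominance -/

/-- A stage element of positive `U`-value has positive `O`-value, for a dominator `U` of the tower (stages invert their
`O`-units, tree `inv_mem_locAt`). [this work] -/
theorem valuation_lt_one_of_dominator (O U : ValuationSubring K) (A : Subalgebra k K)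
    (hk : ∀ c : k, algebraMap k K c ∈ O) (hAO : A.toSubring ≤ O.toSubring)
    (hdom : ∀ m : ℕ, ∀ s ∈ tower O A m, s ∈ U ∧ (s⁻¹ ∈ U → s⁻¹ ∈ O))
    {m : ℕ} {s : K} (hs : s ∈ tower O A m) (hv : U.valuation s < 1) : O.valuation s < 1 := by
  have hsO : s ∈ O := stage_le O A hk hAO m s hs
  by_contra hge
  have h1 : O.valuation s = 1 := le_antisymm ((O.valuation_le_one_iff s).mpr hsO) (not_lt.mp hge)
  have hs0 : s ≠ 0 := by
    rintro rfl
    simp at h1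
  have hsiO : s⁻¹ ∈ O := (O.valuation_le_one_iff s⁻¹).mp (by rw [map_inv₀, h1, inv_one])
  have hsiT : s⁻¹ ∈ tower O A m := inv_mem_stage O A hk hAO m s hs hsiO
  have hsiU : s⁻¹ ∈ U := (hdom m _ hsiT).1
  have hU1 : U.valuation s = 1 :=
    SyzygyFlattening.valuation_eq_one_of_inv_mem U (hdom m s hs).1 hsiU hs0
  exact absurd hU1 (ne_of_lt hv)

/-- **THREADLESS TRANSFER (PROVED).**  If `U` dominates the `O`-tower of `A` and the towers coincide (tree
`stub_dominanceInvariance`), a singular prime thread of the `U`-tower is one of the `O`-tower. [this work] -/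
theorem singularPrimeThread_of_dominator (O U : ValuationSubring K) (A : Subalgebra k K)
    (hk : ∀ c : k, algebraMap k K c ∈ O) (hAO : A.toSubring ≤ O.toSubring)
    (hdom : ∀ m : ℕ, ∀ s ∈ tower O A m, s ∈ U ∧ (s⁻¹ ∈ U → s⁻¹ ∈ O))
    (hinv : ∀ m : ℕ, tower U A m = tower O A m)
    (h : SingularPrimeThread U A) : SingularPrimeThread O A := by
  have hfun : tower U A = tower O A := funext hinv
  unfold SingularPrimeThread at h ⊢
  rw [hfun] at h
  obtain ⟨P, h1, h2, h3, h4, m, s, hs, hvs, hsP⟩ := h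
  exact ⟨P, h1, h2, h3, h4, m, s, hs, valuation_lt_one_of_dominator O U A hk hAO hdom hs hvs, hsP⟩


/-! ## §3 (PROVED) Case (ii): a non-dominating intermediate of residual transcendence degree `≤ 1` terminates the tower -/

/-- **CASE (ii) (PROVED; COROLLARY A₂ = `TraceSocle.curveCoarsening_terminates`).**  A threadless tower (radical persistence, StrictDrop) with a dominator `U`
and a valuation ring `W₂ ⊇ U`, `k ⊆ W₂`, of residual transcendence degree `≤ 1` that does NOT dominate the tower
(escape witness `s`, `s⁻¹ ∈ W₂ ∖ O`) has a regular stage: `tower U A = tower O A` (tree `stub_dominanceInvariance`),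
threadlessness transfers (§2), and Cor A₂ applies to the datum `(U, A)` and its coarsening `W₂`. [this work] -/
theorem terminates_of_lowResidueIntermediate
    (hP : PersistenceRadical) (hD : StrictDrop) (p : ℕ) (hp : p.Prime)
    (k K : Type) [Field k] [CharP k p] [Field K] [Algebra k K] (O : ValuationSubring K)
    (A : Subalgebra k K) (hk : ∀ c : k, algebraMap k K c ∈ O) (hA : A.FG)
    (hfr : IsFractionRing ↥A K) (hAO : A.toSubring ≤ O.toSubring)
    (hthr : ¬ SingularPrimeThread O A)
    (U W₂ : ValuationSubring K) (hUW₂ : U ≤ W₂)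
    (hdom : ∀ m : ℕ, ∀ s ∈ tower O A m, s ∈ U ∧ (s⁻¹ ∈ U → s⁻¹ ∈ O))
    (hesc : ∃ m : ℕ, ∃ s ∈ tower O A m, s⁻¹ ∈ W₂ ∧ s⁻¹ ∉ O)
    (hkW₂ : ∀ c : k, algebraMap k K c ∈ W₂)
    (hW1 : letI : Algebra k ↥W₂ := algebraOfMem k W₂ hkW₂; Algebra.trdeg k (ResidueField ↥W₂) ≤ 1) :
    ∃ m : ℕ, IsRegularLocalRing ↥(tower O A m) := by
  classical
  have hN : ∀ m : ℕ, IsNoetherianRing ↥(tower O A m) := stub_towerNoetherian k K O A hk hA hfr hAO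
  have hinv : ∀ m : ℕ, tower U A m = tower O A m := stub_dominanceInvariance k K O U A hk hAO hN hdom
  have hA0 : A ≤ tower O A 0 := (tn_tower_invariant O A hk hA hfr hAO 0).1
  have hkU : ∀ c : k, algebraMap k K c ∈ U := fun c => (hdom 0 _ (hA0 (A.algebraMap_mem c))).1
  have hAU : A.toSubring ≤ U.toSubring := fun x hx => (hdom 0 x (hA0 hx)).1
  have hthrU : ¬ SingularPrimeThread U A :=
    fun h => hthr (singularPrimeThread_of_dominator O U A hk hAO hdom hinv h)
  have hescU : ∃ m : ℕ, ∃ s ∈ tower U A m, s⁻¹ ∈ W₂ ∧ s⁻¹ ∉ U := by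
    obtain ⟨m, s, hs, hsW, hsO⟩ := hesc
    refine ⟨m, s, ?_, hsW, fun h => hsO ((hdom m s hs).2 h)⟩
    rw [hinv m]; exact hs
  letI : Algebra k ↥W₂ := algebraOfMem k W₂ hkW₂
  haveI : IsScalarTower k ↥W₂ K := isScalarTower_algebraOfMem k W₂ hkW₂
  obtain ⟨m, hm⟩ := curveCoarsening_terminates hP hD p hp k K U A hkU hA hfr hAU hthrU W₂ hUW₂ hescU hW1
  rw [hinv m] at hm
  exact ⟨m, hm⟩


/-! ## §4 (PROVED) Case (i) at K-level: a trace dominator with NOETHERIAN image terminates the tower -/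

/-- **CASE (i) (PROVED; FACT 2 = `TraceSocle.terminates_of_noetherianResidualDominator`).**  For a K-level dominator `U ≤ W` of a threadless tower inside `W` with an escape
witness into `W`, `Ū := U/𝔪_W = residueValuationSubring U W` contains the stage residues and dominates the residual
union (tree `residue_mem_residueValuationSubring_iff`, `residue_mk_inv`); if `Ū` is noetherian the tower terminates.
[this work] -/
theorem terminates_of_noetherianImage
    (hP : PersistenceRadical) (hD : StrictDrop) (p : ℕ) (hp : p.Prime)
    (k K : Type) [Field k] [CharP k p] [Field K] [Algebra k K] (O : ValuationSubring K)
    (A : Subalgebra k K) (hk : ∀ c : k, algebraMap k K c ∈ O) (hA : A.FG)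
    (hfr : IsFractionRing ↥A K) (hAO : A.toSubring ≤ O.toSubring)
    (hthr : ¬ SingularPrimeThread O A) (W : ValuationSubring K) (m₁ : ℕ)
    (hesc : ∃ s ∈ tower O A m₁, s⁻¹ ∈ W ∧ s⁻¹ ∉ O)
    (hW : ∀ m : ℕ, ∀ s ∈ tower O A m, s ∈ W)
    (U : ValuationSubring K) (hUW : U ≤ W)
    (hdom : ∀ m : ℕ, ∀ s ∈ tower O A m, s ∈ U ∧ (s⁻¹ ∈ U → s⁻¹ ∈ O))
    (hN : IsNoetherianRing ↥(residueValuationSubring U W hUW)) :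
    ∃ m : ℕ, IsRegularLocalRing ↥(tower O A m) := by
  refine terminates_of_noetherianResidualDominator hP hD p hp k K O A hk hA hfr hAO hthr W m₁ hesc hW
    (residueValuationSubring U W hUW)
    (fun m s hs => ?_) (fun m s hs hsiW h => ?_) hN
  · exact (residue_mem_residueValuationSubring_iff U W hUW ⟨s, hW m s hs⟩).mpr (hdom m s hs).1
  · rcases eq_or_ne s 0 with rfl | hs0
    · rw [inv_zero]; exact O.zero_mem
    rw [← residue_mk_inv W (hW m s hs) hsiW hs0] at h
    exact (hdom m s hs).2 ((residue_mem_residueValuationSubring_iff U W hUW ⟨s⁻¹, hsiW⟩).mp h)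


/-! ## §5 (PROVED) The trichotomy composition: the confined branch from the surface-confined residual -/

/-- **THE TRICHOTOMY COMPOSITION (PROVED).**  The confined branch (b) of β1ʳ¹♯ (the line's `Sig.Beta1SharpConfined`, text below the colon)
follows from the residual (iii) (`Sig.SurfaceConfinedResidual`, the binder text): unpack confinement; all stages lie in `W`; a trace
dominator `U = W ∘ Ū` exists (`TraceSocle.exists_traceDominator` + `dominates_residueLift`); if the conclusion failed, every trace dominator
would have non-noetherian image (else CASE (i)) and every low-residue intermediate would dominate (else CASE (ii)) — and then the residual
concludes. [this work] -/
theorem beta1SharpConfined_of_residual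
    (hR :
      PersistenceRadical → StrictDrop → ∀ p : ℕ, p.Prime → ∀ (k K : Type) [Field k] [CharP k p] [Field K]
        [Algebra k K] (O : ValuationSubring K) (A : Subalgebra k K), (∀ c : k, algebraMap k K c ∈ O) →
        A.FG → IsFractionRing ↥A K → A.toSubring ≤ O.toSubring →
        (∀ O' : ValuationSubring K,
          (∀ m : ℕ, ∀ s ∈ tower O A m, s ∈ O' ∧ (s⁻¹ ∈ O' → s⁻¹ ∈ O)) → ¬ IsNoetherianRing ↥O') →
        (∀ O' : ValuationSubring K, O < O' → ∃ m : ℕ, ∃ s ∈ tower O A m, s⁻¹ ∈ O' ∧ s⁻¹ ∉ O) →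
        (∀ (k' K' : Type) [Field k'] [CharP k' p] [Field K'] [Algebra k' K'] (O' : ValuationSubring K')
          (A' : Subalgebra k' K'), (∀ c : k', algebraMap k' K' c ∈ O') → A'.FG → IsFractionRing ↥A' K' →
          A'.toSubring ≤ O'.toSubring → Algebra.trdeg k' K' < Algebra.trdeg k K →
          ∃ m : ℕ, IsRegularLocalRing ↥(tower O' A' m)) →
        (∀ m : ℕ, ∀ s ∈ tower O A m, ∃ f : Polynomial k, f ≠ 0 ∧ O.valuation (Polynomial.aeval s f) < 1) →
        3 ≤ Algebra.trdeg k K →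
        (∀ O₁ : ValuationSubring K, O < O₁ → O₁ = ⊤) →
        (∃ t : K, t ∈ O ∧ (∀ m : ℕ, t ∉ tower O A m) ∧
          ∀ f : Polynomial k, f ≠ 0 → ¬ O.valuation (Polynomial.aeval t f) < 1) →
        ¬ SingularPrimeThread O A →
        ∀ (W : ValuationSubring K) (m₁ : ℕ), (∀ s ∈ tower O A m₁, s ∈ W) →
        (∃ s ∈ tower O A m₁, s⁻¹ ∈ W ∧ s⁻¹ ∉ O) → (∃ t ∈ tower O A m₁, t ≠ 0 ∧ t⁻¹ ∉ W) →
        (∀ m : ℕ, m₁ ≤ m → tower O A m ≤ loc W (tower O A m₁)) →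
        (∀ m : ℕ, ∀ s ∈ tower O A m, s ∈ W) →
        (∃ U : ValuationSubring K, U ≤ W ∧ ∀ m : ℕ, ∀ s ∈ tower O A m, s ∈ U ∧ (s⁻¹ ∈ U → s⁻¹ ∈ O)) →
        (∀ (U : ValuationSubring K) (hUW : U ≤ W),
          (∀ m : ℕ, ∀ s ∈ tower O A m, s ∈ U ∧ (s⁻¹ ∈ U → s⁻¹ ∈ O)) →
          ¬ IsNoetherianRing ↥(residueValuationSubring U W hUW) ∧
          ∀ (W₂ : ValuationSubring K) (hkW₂ : ∀ c : k, algebraMap k K c ∈ W₂), U < W₂ → W₂ < W →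
            (letI : Algebra k ↥W₂ := algebraOfMem k W₂ hkW₂; Algebra.trdeg k (ResidueField ↥W₂) ≤ 1) →
            ∀ m : ℕ, ∀ s ∈ tower O A m, s⁻¹ ∈ W₂ → s⁻¹ ∈ O) →
        ∃ m : ℕ, IsRegularLocalRing ↥(tower O A m)) :
    PersistenceRadical → StrictDrop → ∀ p : ℕ, p.Prime → ∀ (k K : Type) [Field k] [CharP k p] [Field K]
      [Algebra k K] (O : ValuationSubring K) (A : Subalgebra k K), (∀ c : k, algebraMap k K c ∈ O) →
      A.FG → IsFractionRing ↥A K → A.toSubring ≤ O.toSubring →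
      (∀ O' : ValuationSubring K,
        (∀ m : ℕ, ∀ s ∈ tower O A m, s ∈ O' ∧ (s⁻¹ ∈ O' → s⁻¹ ∈ O)) → ¬ IsNoetherianRing ↥O') →
      (∀ O' : ValuationSubring K, O < O' → ∃ m : ℕ, ∃ s ∈ tower O A m, s⁻¹ ∈ O' ∧ s⁻¹ ∉ O) →
      (∀ (k' K' : Type) [Field k'] [CharP k' p] [Field K'] [Algebra k' K'] (O' : ValuationSubring K')
        (A' : Subalgebra k' K'), (∀ c : k', algebraMap k' K' c ∈ O') → A'.FG → IsFractionRing ↥A' K' →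
        A'.toSubring ≤ O'.toSubring → Algebra.trdeg k' K' < Algebra.trdeg k K →
        ∃ m : ℕ, IsRegularLocalRing ↥(tower O' A' m)) →
      (∀ m : ℕ, ∀ s ∈ tower O A m, ∃ f : Polynomial k, f ≠ 0 ∧ O.valuation (Polynomial.aeval s f) < 1) →
      3 ≤ Algebra.trdeg k K →
      (∀ O₁ : ValuationSubring K, O < O₁ → O₁ = ⊤) →
      (∃ t : K, t ∈ O ∧ (∀ m : ℕ, t ∉ tower O A m) ∧
        ∀ f : Polynomial k, f ≠ 0 → ¬ O.valuation (Polynomial.aeval t f) < 1) →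
      (∃ W : ValuationSubring K, ∃ m₁ : ℕ, (∀ s ∈ tower O A m₁, s ∈ W) ∧
      (∃ s ∈ tower O A m₁, s⁻¹ ∈ W ∧ s⁻¹ ∉ O) ∧ (∃ t ∈ tower O A m₁, t ≠ 0 ∧ t⁻¹ ∉ W) ∧
      ∀ m : ℕ, m₁ ≤ m → tower O A m ≤ loc W (tower O A m₁)) →
      ¬ SingularPrimeThread O A →
      ∃ m : ℕ, IsRegularLocalRing ↥(tower O A m) := by
  intro hP hD p hp k K _ _ _ _ O A hk hA hfr hAO hker hmax IH hzd htr hr1 hb hconf hthr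
  classical
  obtain ⟨W, m₁, hWT, hesc, htW, hcf⟩ := hconf
  -- every stage lies in `W`
  have hW : ∀ m : ℕ, ∀ s ∈ tower O A m, s ∈ W := by
    intro m s hs
    rcases le_total m m₁ with hle | hle
    · exact hWT s (d2rc_mem_tower_of_le O A hle hs)
    · exact loc_le W _ hWT _ (hcf m hle hs)
  -- a trace dominator exists
  obtain ⟨Ū, hres, hdomr⟩ := exists_traceDominator O A hk hAO W hW
  have hU : ∃ U : ValuationSubring K, U ≤ W ∧
      ∀ m : ℕ, ∀ s ∈ tower O A m, s ∈ U ∧ (s⁻¹ ∈ U → s⁻¹ ∈ O) :=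
    ⟨residueOverringLift W Ū, residueOverringLift_le W Ū, dominates_residueLift O A W Ū hW hres hdomr⟩
  by_contra hnone
  refine hnone (hR hP hD p hp k K O A hk hA hfr hAO hker hmax IH hzd htr hr1 hb hthr W m₁ hWT hesc htW hcf
    hW hU ?_)
  intro U hUW hdom
  refine ⟨fun hN => hnone ?_, fun W₂ hkW₂ hUW₂ hW₂W hW1 m s hs hsi => ?_⟩
  · -- CASE (i)
    exact terminates_of_noetherianImage hP hD p hp k K O A hk hA hfr hAO hthr W m₁ hesc hW U hUW hdom hN
  · -- CASE (ii)
    by_contra hsO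
    exact hnone (terminates_of_lowResidueIntermediate hP hD p hp k K O A hk hA hfr hAO hthr U W₂
      hUW₂.le hdom ⟨m, s, hs, hsi, hsO⟩ hkW₂ hW1)

/-- **SHARPENING GLUE (PROVED)**: the residual (iii) from its SHARP form (the binder: one more hypothesis — two stage-`m₁` elements with
`k`-algebraically INDEPENDENT `W`-residues) — if no two stage-`m₁` elements have independent residues, THEOREM A in def-free form
(`TraceSocle.curveTrace_terminates`) terminates the tower; otherwise the sharp residual applies. [this work] -/
theorem surfaceConfinedResidual_of_sharp
    (hR :
      PersistenceRadical → StrictDrop → ∀ p : ℕ, p.Prime → ∀ (k K : Type) [Field k] [CharP k p] [Field K]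
        [Algebra k K] (O : ValuationSubring K) (A : Subalgebra k K), (∀ c : k, algebraMap k K c ∈ O) →
        A.FG → IsFractionRing ↥A K → A.toSubring ≤ O.toSubring →
        (∀ O' : ValuationSubring K,
          (∀ m : ℕ, ∀ s ∈ tower O A m, s ∈ O' ∧ (s⁻¹ ∈ O' → s⁻¹ ∈ O)) → ¬ IsNoetherianRing ↥O') →
        (∀ O' : ValuationSubring K, O < O' → ∃ m : ℕ, ∃ s ∈ tower O A m, s⁻¹ ∈ O' ∧ s⁻¹ ∉ O) →
        (∀ (k' K' : Type) [Field k'] [CharP k' p] [Field K'] [Algebra k' K'] (O' : ValuationSubring K')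
          (A' : Subalgebra k' K'), (∀ c : k', algebraMap k' K' c ∈ O') → A'.FG → IsFractionRing ↥A' K' →
          A'.toSubring ≤ O'.toSubring → Algebra.trdeg k' K' < Algebra.trdeg k K →
          ∃ m : ℕ, IsRegularLocalRing ↥(tower O' A' m)) →
        (∀ m : ℕ, ∀ s ∈ tower O A m, ∃ f : Polynomial k, f ≠ 0 ∧ O.valuation (Polynomial.aeval s f) < 1) →
        3 ≤ Algebra.trdeg k K →
        (∀ O₁ : ValuationSubring K, O < O₁ → O₁ = ⊤) →
        (∃ t : K, t ∈ O ∧ (∀ m : ℕ, t ∉ tower O A m) ∧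
          ∀ f : Polynomial k, f ≠ 0 → ¬ O.valuation (Polynomial.aeval t f) < 1) →
        ¬ SingularPrimeThread O A →
        ∀ (W : ValuationSubring K) (m₁ : ℕ), (∀ s ∈ tower O A m₁, s ∈ W) →
        (∃ s ∈ tower O A m₁, s⁻¹ ∈ W ∧ s⁻¹ ∉ O) → (∃ t ∈ tower O A m₁, t ≠ 0 ∧ t⁻¹ ∉ W) →
        (∀ m : ℕ, m₁ ≤ m → tower O A m ≤ loc W (tower O A m₁)) →
        (∀ m : ℕ, ∀ s ∈ tower O A m, s ∈ W) →
        (∃ a ∈ tower O A m₁, ∃ b ∈ tower O A m₁, ∀ f : MvPolynomial (Fin 2) k, f ≠ 0 →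
          W.valuation (MvPolynomial.aeval ![a, b] f) = 1) →
        (∃ U : ValuationSubring K, U ≤ W ∧ ∀ m : ℕ, ∀ s ∈ tower O A m, s ∈ U ∧ (s⁻¹ ∈ U → s⁻¹ ∈ O)) →
        (∀ (U : ValuationSubring K) (hUW : U ≤ W),
          (∀ m : ℕ, ∀ s ∈ tower O A m, s ∈ U ∧ (s⁻¹ ∈ U → s⁻¹ ∈ O)) →
          ¬ IsNoetherianRing ↥(residueValuationSubring U W hUW) ∧
          ∀ (W₂ : ValuationSubring K) (hkW₂ : ∀ c : k, algebraMap k K c ∈ W₂), U < W₂ → W₂ < W →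
            (letI : Algebra k ↥W₂ := algebraOfMem k W₂ hkW₂; Algebra.trdeg k (ResidueField ↥W₂) ≤ 1) →
            ∀ m : ℕ, ∀ s ∈ tower O A m, s⁻¹ ∈ W₂ → s⁻¹ ∈ O) →
        ∃ m : ℕ, IsRegularLocalRing ↥(tower O A m)) :
    PersistenceRadical → StrictDrop → ∀ p : ℕ, p.Prime → ∀ (k K : Type) [Field k] [CharP k p] [Field K]
      [Algebra k K] (O : ValuationSubring K) (A : Subalgebra k K), (∀ c : k, algebraMap k K c ∈ O) →
      A.FG → IsFractionRing ↥A K → A.toSubring ≤ O.toSubring →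
      (∀ O' : ValuationSubring K,
        (∀ m : ℕ, ∀ s ∈ tower O A m, s ∈ O' ∧ (s⁻¹ ∈ O' → s⁻¹ ∈ O)) → ¬ IsNoetherianRing ↥O') →
      (∀ O' : ValuationSubring K, O < O' → ∃ m : ℕ, ∃ s ∈ tower O A m, s⁻¹ ∈ O' ∧ s⁻¹ ∉ O) →
      (∀ (k' K' : Type) [Field k'] [CharP k' p] [Field K'] [Algebra k' K'] (O' : ValuationSubring K')
        (A' : Subalgebra k' K'), (∀ c : k', algebraMap k' K' c ∈ O') → A'.FG → IsFractionRing ↥A' K' →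
        A'.toSubring ≤ O'.toSubring → Algebra.trdeg k' K' < Algebra.trdeg k K →
        ∃ m : ℕ, IsRegularLocalRing ↥(tower O' A' m)) →
      (∀ m : ℕ, ∀ s ∈ tower O A m, ∃ f : Polynomial k, f ≠ 0 ∧ O.valuation (Polynomial.aeval s f) < 1) →
      3 ≤ Algebra.trdeg k K →
      (∀ O₁ : ValuationSubring K, O < O₁ → O₁ = ⊤) →
      (∃ t : K, t ∈ O ∧ (∀ m : ℕ, t ∉ tower O A m) ∧
        ∀ f : Polynomial k, f ≠ 0 → ¬ O.valuation (Polynomial.aeval t f) < 1) →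
      ¬ SingularPrimeThread O A →
      ∀ (W : ValuationSubring K) (m₁ : ℕ), (∀ s ∈ tower O A m₁, s ∈ W) →
      (∃ s ∈ tower O A m₁, s⁻¹ ∈ W ∧ s⁻¹ ∉ O) → (∃ t ∈ tower O A m₁, t ≠ 0 ∧ t⁻¹ ∉ W) →
      (∀ m : ℕ, m₁ ≤ m → tower O A m ≤ loc W (tower O A m₁)) →
      (∀ m : ℕ, ∀ s ∈ tower O A m, s ∈ W) →
      (∃ U : ValuationSubring K, U ≤ W ∧ ∀ m : ℕ, ∀ s ∈ tower O A m, s ∈ U ∧ (s⁻¹ ∈ U → s⁻¹ ∈ O)) →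
      (∀ (U : ValuationSubring K) (hUW : U ≤ W),
        (∀ m : ℕ, ∀ s ∈ tower O A m, s ∈ U ∧ (s⁻¹ ∈ U → s⁻¹ ∈ O)) →
        ¬ IsNoetherianRing ↥(residueValuationSubring U W hUW) ∧
        ∀ (W₂ : ValuationSubring K) (hkW₂ : ∀ c : k, algebraMap k K c ∈ W₂), U < W₂ → W₂ < W →
          (letI : Algebra k ↥W₂ := algebraOfMem k W₂ hkW₂; Algebra.trdeg k (ResidueField ↥W₂) ≤ 1) →
          ∀ m : ℕ, ∀ s ∈ tower O A m, s⁻¹ ∈ W₂ → s⁻¹ ∈ O) →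
      ∃ m : ℕ, IsRegularLocalRing ↥(tower O A m) := by
  intro hP hD p hp k K _ _ _ _ O A hk hA' hfr hAO hker hmax IH hzd htr hr1 hb hthr W m₁ hWT hesc htW hcf hW hU hall
  classical
  by_cases hsurf : ∃ a ∈ tower O A m₁, ∃ b ∈ tower O A m₁, ∀ f : MvPolynomial (Fin 2) k, f ≠ 0 →
      W.valuation (MvPolynomial.aeval ![a, b] f) = 1
  · exact hR hP hD p hp k K O A hk hA' hfr hAO hker hmax IH hzd htr hr1 hb hthr W m₁ hWT hesc htW hcf hW hsurf
      hU hall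
  · push Not at hsurf
    exact curveTrace_terminates hP hD p hp k K O A hk hA' hfr hAO hthr W m₁ hWT hesc hcf hsurf

/-- **The confined branch from the SHARP residual (PROVED).** [this work] -/
theorem beta1SharpConfined_of_sharp
    (hR :
      PersistenceRadical → StrictDrop → ∀ p : ℕ, p.Prime → ∀ (k K : Type) [Field k] [CharP k p] [Field K]
        [Algebra k K] (O : ValuationSubring K) (A : Subalgebra k K), (∀ c : k, algebraMap k K c ∈ O) →
        A.FG → IsFractionRing ↥A K → A.toSubring ≤ O.toSubring →
        (∀ O' : ValuationSubring K,
          (∀ m : ℕ, ∀ s ∈ tower O A m, s ∈ O' ∧ (s⁻¹ ∈ O' → s⁻¹ ∈ O)) → ¬ IsNoetherianRing ↥O') →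
        (∀ O' : ValuationSubring K, O < O' → ∃ m : ℕ, ∃ s ∈ tower O A m, s⁻¹ ∈ O' ∧ s⁻¹ ∉ O) →
        (∀ (k' K' : Type) [Field k'] [CharP k' p] [Field K'] [Algebra k' K'] (O' : ValuationSubring K')
          (A' : Subalgebra k' K'), (∀ c : k', algebraMap k' K' c ∈ O') → A'.FG → IsFractionRing ↥A' K' →
          A'.toSubring ≤ O'.toSubring → Algebra.trdeg k' K' < Algebra.trdeg k K →
          ∃ m : ℕ, IsRegularLocalRing ↥(tower O' A' m)) →
        (∀ m : ℕ, ∀ s ∈ tower O A m, ∃ f : Polynomial k, f ≠ 0 ∧ O.valuation (Polynomial.aeval s f) < 1) →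
        3 ≤ Algebra.trdeg k K →
        (∀ O₁ : ValuationSubring K, O < O₁ → O₁ = ⊤) →
        (∃ t : K, t ∈ O ∧ (∀ m : ℕ, t ∉ tower O A m) ∧
          ∀ f : Polynomial k, f ≠ 0 → ¬ O.valuation (Polynomial.aeval t f) < 1) →
        ¬ SingularPrimeThread O A →
        ∀ (W : ValuationSubring K) (m₁ : ℕ), (∀ s ∈ tower O A m₁, s ∈ W) →
        (∃ s ∈ tower O A m₁, s⁻¹ ∈ W ∧ s⁻¹ ∉ O) → (∃ t ∈ tower O A m₁, t ≠ 0 ∧ t⁻¹ ∉ W) →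
        (∀ m : ℕ, m₁ ≤ m → tower O A m ≤ loc W (tower O A m₁)) →
        (∀ m : ℕ, ∀ s ∈ tower O A m, s ∈ W) →
        (∃ a ∈ tower O A m₁, ∃ b ∈ tower O A m₁, ∀ f : MvPolynomial (Fin 2) k, f ≠ 0 →
          W.valuation (MvPolynomial.aeval ![a, b] f) = 1) →
        (∃ U : ValuationSubring K, U ≤ W ∧ ∀ m : ℕ, ∀ s ∈ tower O A m, s ∈ U ∧ (s⁻¹ ∈ U → s⁻¹ ∈ O)) →
        (∀ (U : ValuationSubring K) (hUW : U ≤ W),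
          (∀ m : ℕ, ∀ s ∈ tower O A m, s ∈ U ∧ (s⁻¹ ∈ U → s⁻¹ ∈ O)) →
          ¬ IsNoetherianRing ↥(residueValuationSubring U W hUW) ∧
          ∀ (W₂ : ValuationSubring K) (hkW₂ : ∀ c : k, algebraMap k K c ∈ W₂), U < W₂ → W₂ < W →
            (letI : Algebra k ↥W₂ := algebraOfMem k W₂ hkW₂; Algebra.trdeg k (ResidueField ↥W₂) ≤ 1) →
            ∀ m : ℕ, ∀ s ∈ tower O A m, s⁻¹ ∈ W₂ → s⁻¹ ∈ O) →
        ∃ m : ℕ, IsRegularLocalRing ↥(tower O A m)) :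
    PersistenceRadical → StrictDrop → ∀ p : ℕ, p.Prime → ∀ (k K : Type) [Field k] [CharP k p] [Field K]
      [Algebra k K] (O : ValuationSubring K) (A : Subalgebra k K), (∀ c : k, algebraMap k K c ∈ O) →
      A.FG → IsFractionRing ↥A K → A.toSubring ≤ O.toSubring →
      (∀ O' : ValuationSubring K,
        (∀ m : ℕ, ∀ s ∈ tower O A m, s ∈ O' ∧ (s⁻¹ ∈ O' → s⁻¹ ∈ O)) → ¬ IsNoetherianRing ↥O') →
      (∀ O' : ValuationSubring K, O < O' → ∃ m : ℕ, ∃ s ∈ tower O A m, s⁻¹ ∈ O' ∧ s⁻¹ ∉ O) →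
      (∀ (k' K' : Type) [Field k'] [CharP k' p] [Field K'] [Algebra k' K'] (O' : ValuationSubring K')
        (A' : Subalgebra k' K'), (∀ c : k', algebraMap k' K' c ∈ O') → A'.FG → IsFractionRing ↥A' K' →
        A'.toSubring ≤ O'.toSubring → Algebra.trdeg k' K' < Algebra.trdeg k K →
        ∃ m : ℕ, IsRegularLocalRing ↥(tower O' A' m)) →
      (∀ m : ℕ, ∀ s ∈ tower O A m, ∃ f : Polynomial k, f ≠ 0 ∧ O.valuation (Polynomial.aeval s f) < 1) →
      3 ≤ Algebra.trdeg k K →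
      (∀ O₁ : ValuationSubring K, O < O₁ → O₁ = ⊤) →
      (∃ t : K, t ∈ O ∧ (∀ m : ℕ, t ∉ tower O A m) ∧
        ∀ f : Polynomial k, f ≠ 0 → ¬ O.valuation (Polynomial.aeval t f) < 1) →
      (∃ W : ValuationSubring K, ∃ m₁ : ℕ, (∀ s ∈ tower O A m₁, s ∈ W) ∧
      (∃ s ∈ tower O A m₁, s⁻¹ ∈ W ∧ s⁻¹ ∉ O) ∧ (∃ t ∈ tower O A m₁, t ≠ 0 ∧ t⁻¹ ∉ W) ∧
      ∀ m : ℕ, m₁ ≤ m → tower O A m ≤ loc W (tower O A m₁)) →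
      ¬ SingularPrimeThread O A →
      ∃ m : ℕ, IsRegularLocalRing ↥(tower O A m) :=
  beta1SharpConfined_of_residual (surfaceConfinedResidual_of_sharp hR)


end Summit.ResolutionOfSingularities.ResolutionOfSingularities.Theorems.NoZeno.ConfinedSurface

end
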